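import Summits.ResolutionOfSingularities.ResolutionOfSingularities.Theorems.DeltaCutRun3
import HarnessLib

/-!
# DeltaCutRunJunction — decomp-res node «RunCut» (lens-6 g25, critic row 190 CLEARED +1), tree file 4/7 of the node

Content VERBATIM from the decomp-res lens-6 g25 node `HOME/decomp-res-lens-6/g25/RunCut.lean` (pin e4e94516; NEW
part l. 1187–2651; the node's carry of g24 l. 89–1165 dropped in favour of `import …DeltaCutChain3` /
`…DeltaCutChainCertificates2`); HOME = run/shared/lean/pub/decomp-res; critic row 190 CLEARED +1; landing plan
NEXT-g26.md bfe16773 §4 + rider INBOX :1047 — provenance, critic text and the lens header in full in the first file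
of the node, `DeltaCutRun`.  Namespace `…Theorems.DeltaCutClasses`; `--supports stmt-ResolutionOfSingularities-26971`.

## This file

§RunJunction — JUNCTION WITH LENS-4 (node l. 1803–1860; 0-weight, BY NAME, no tower class re-typed): port-free
`tower_stage_not_chainLightAt` (every stage of a forced tower over base data whose next marked point is wild is
CHAIN-HEAVY in g24's sense), `tower_stage_topChainHeavy(_of_pPowerTower)`, and modulo the tree port `TowerObstructs
n`: `noTowerWild_of_worTopRunHeavy` (`WORTopRunHeavy n → SeqDimFour 5 n → NoTowerWild n P`, every `P ≤ PPowerTower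
n`, via g23 `noTowerWild_of_worTopDeltaHeavy`), `noTowerWild_of_worTopRunHeavy_contactFree`.

[WRITER NOTE (decomp-res writer g12): file split only (tree files ≤ 400 lines); namespace, sections, section opens
and every declaration exactly as in the lens (the carry block and the node's global dupNamespace-linter line are
dropped — the library sets the latter; the two namespace-level `open …TwistCutClasses` / `open …LightCutClasses`
lines of the node are replayed).]

(Sources: Hironaka1967 (characteristic polyhedra); CossartJannsenSaito2020 Def. 3.13 / Thm. 3.14, Ch. 8, Thm. 9.6;
Hironaka1970 (near points / vertices); CossartPiltant2019 Prop. 2.6; CossartPiltant2008 §2; Giraud1975; Hironaka2005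
(three key theorems: order under permissible blow-up); König 1927 (Kőnig's lemma) as Mathlib
`nonempty_sections_of_finite_inverse_system`; EGAIV4 §16–§17; StacksProject 0804 / 0BIQ / 031I; Matsumura1987 §28.)
-/

noncomputable section

open CategoryTheory CategoryTheory.Limits AlgebraicGeometry TopologicalSpace IsLocalRing
open Literature.AlgebraicGeometry.Resolution

universe u

namespace Summit.ResolutionOfSingularities.ResolutionOfSingularities.Theorems.DeltaCutClasses

open Summit.ResolutionOfSingularities.ResolutionOfSingularities.Theorems.TwistCutClasses
open Summit.ResolutionOfSingularities.ResolutionOfSingularities.Theorems.LightCutClasses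

section RunJunction

open Summit.ResolutionOfSingularities.ResolutionOfSingularities.Theorems
open WeakOrderReduction ForcedTowerClasses SubfieldContactClasses AbsoluteContactClasses PurityValveClasses
open HugValuationCut
variable {K : Type} [Field K]

/-! ### §RunJunction — JUNCTION WITH LENS-4 (0-weight, BY NAME; no tower class re-typed) -/

/-- **KERNEL (PORT-FREE): EVERY STAGE OF A FORCED TOWER OVER BASE DATA WHOSE NEXT MARKED POINT IS WILD IS NOT CHAIN-LIGHT** —
the next marked point `x_{j+1}` is a WILD NEAR POINT of `x_j` (closed, order `n` by `idealOrder_pt_eq_of_isDatum` ∘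
`tower_isDatum`,
the ideal upstairs is the controlled transform at marking `n` by `tower_mult_eq`) which is NOT δ-light (g23
`tower_stage_not_deltaLightAt`). [new] [folklore] -/
theorem tower_stage_not_chainLightAt (T : ForcedTower) (g : T.St 0 ⟶ Spec (.of K)) (hB : IsBase (T.St 0) g) {n : ℕ}
    (hn : 1 ≤ n) (hD : IsDatum n (T.D 0)) (j : ℕ) (hw : ¬ IsAbsContactAt (T.D (j + 1)).ideal n (T.pt (j + 1))) :
    ¬ ChainLightAt (T.D j).ideal n (T.pt j) := by
  intro hcl
  have hDj1 : (T.D (j + 1)).ideal = controlledTransform (T.π j) (T.centre j) (T.D j).ideal n := by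
    rw [T.transform_eq j, MarkedIdeal.transform_ideal, tower_mult_eq T hD j]
  have hord : idealOrder (T.D (j + 1)).ideal (T.pt (j + 1)) = ((n : ℕ) : ℕ∞) :=
    idealOrder_pt_eq_of_isDatum T (j + 1) (tower_isDatum T g hB hD (j + 1))
  rw [hDj1] at hord hw
  have hδ := hcl (T.centre j) (T.St (j + 1)) (T.π j) (T.centre_support j) (T.centre_regular j) (T.isBlowup j)
    (T.pt (j + 1)) (T.pt_map j) (T.isClosed_pt (j + 1)) hord hw
  rw [← hDj1] at hδ
  exact tower_stage_not_deltaLightAt T g hB hn hD (j + 1) hδ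

/-- **KERNEL (PORT-FREE): SUCH A STAGE, IF ITSELF WILD, LIES IN g24's RESIDUAL LOCUS `TopChainHeavy`** (its marked
point is a bad
point — g23 `tower_stage_topDeltaHeavy` — that is not chain-light). [new] [folklore] -/
theorem tower_stage_topChainHeavy (T : ForcedTower) (g : T.St 0 ⟶ Spec (.of K)) (hB : IsBase (T.St 0) g) {n : ℕ}
    (hn : 1 ≤ n) (hD : IsDatum n (T.D 0)) (j : ℕ) (hwj : ¬ IsAbsContactAt (T.D j).ideal n (T.pt j))
    (hw : ¬ IsAbsContactAt (T.D (j + 1)).ideal n (T.pt (j + 1))) : TopChainHeavy (T.St j) (T.D j).ideal n :=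
  Or.inr ⟨T.pt j, ⟨T.isClosed_pt j, idealOrder_pt_eq_of_isDatum T j (tower_isDatum T g hB hD j), hwj,
    tower_stage_not_deltaLightAt T g hB hn hD j⟩, tower_stage_not_chainLightAt T g hB hn hD j hw⟩

/-- the same for `p`-POWER towers (lens-4's wild letter `PPowerTower`): EVERY stage lies in `TopChainHeavy`. [new] [folklore] -/
theorem tower_stage_topChainHeavy_of_pPowerTower {p : ℕ} [Fact p.Prime] [CharP K p] (T : ForcedTower)
    (g : T.St 0 ⟶ Spec (.of K)) (hB : IsBase (T.St 0) g) {n : ℕ} (hn : 1 ≤ n) (hD : IsDatum n (T.D 0))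
    (hP : PPowerTower n T) (j : ℕ) : TopChainHeavy (T.St j) (T.D j).ideal n := by
  haveI := charP_stalk_stage (p := p) T g j
  haveI := charP_stalk_stage (p := p) T g (j + 1)
  exact tower_stage_topChainHeavy T g hB hn hD j
    (not_isAbsContactAt_of_pPowerFormAt (p := p) (show 0 < n by omega) (hP j p Fact.out inferInstance))
    (not_isAbsContactAt_of_pPowerFormAt (p := p) (show 0 < n by omega) (hP (j + 1) p Fact.out inferInstance))

/-- **KERNEL `→` (modulo the tree's port `TowerObstructs n`): THE RUN RESIDUAL IMPLIES EVERY WILD (`p`-POWER) TOWER RESIDUAL** —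
`WORTopRunHeavy n → NoTowerWild n P` for every class `P ≤ PPowerTower n`, given `SeqDimFour 5 n` (g23
`noTowerWild_of_worTopDeltaHeavy` ∘ the re-location `worTopDeltaHeavy_iff_worTopRunHeavy`). [new] [folklore] -/
theorem noTowerWild_of_worTopRunHeavy {n : ℕ} (hn : 1 ≤ n) (hT : TowerObstructs n) (h5 : SeqDimFour 5 n)
    (h : WORTopRunHeavy n) (P : ForcedTower → Prop) (hP : ∀ T, P T → PPowerTower n T) : NoTowerWild n P :=
  noTowerWild_of_worTopDeltaHeavy hn hT ((worTopDeltaHeavy_iff_worTopRunHeavy hn h5).2 h) P hP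

/-- the same for ABSOLUTELY CONTACT-FREE classes `P ≤ ContactFreeTower n`. [new] [folklore] -/
theorem noTowerWild_of_worTopRunHeavy_contactFree {n : ℕ} (hn : 1 ≤ n) (hT : TowerObstructs n) (h5 : SeqDimFour 5 n)
    (h : WORTopRunHeavy n) (P : ForcedTower → Prop) (hP : ∀ T, P T → ContactFreeTower n T) : NoTowerWild n P :=
  noTowerWild_of_worTopDeltaHeavy_contactFree hn hT ((worTopDeltaHeavy_iff_worTopRunHeavy hn h5).2 h) P hP

end RunJunction

end Summit.ResolutionOfSingularities.ResolutionOfSingularities.Theorems.DeltaCutClasses
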